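import Literature.Analysis.FluidPDE.GigaMiura2011DirectionGradientCriterion
import Summits.NavierStokesRegularity.NavierStokesRegularity.Theorems.ScaledTopAlignmentGigaMiuraDirectionGradientLaLb
import HarnessLib

/-!
# Route `ScaledTopAlignment`: discharge of the Literature statement of Giga–Miura 2011, Rmk. 2.8
# (the `L^a(L^b)` family; support for the deciding crux W3ᵐᵗ = `AprioriMostTimesBulkAlignment`,
# stmt-NavierStokesRegularity-19551)

The named fact `Literature.Analysis.FluidPDE.gigaMiura2011_directionGradient_LaLb_typeI`
(`Literature/Analysis/FluidPDE/GigaMiura2011DirectionGradientCriterion.lean`: Type I +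
`∇ξ ∈ L^a(0,T; L^b(Ω_d))`, `2/a + 3/b = 1`, `3 < b < ∞` ⇒ continuation past `T`; HUPS #956 p. 10)
is, verbatim, the type of the tree theorem `hasSmoothExtensionPast_of_directionGradient_LaLb_typeI`
(`ScaledTopAlignmentGigaMiuraDirectionGradientLaLb`); this file records the discharge BY NAME
(net debt of the statement: 0).
WHAT THIS IS NOT: not NS regularity — a Type-I-conditional criterion from print; W3ᵐᵗ and the
residual NoTypeII (stmt-0056) are untouched.
-/

-- the summit and its single sub-problem share the name (CONVENTIONS §1), as in every Theorems file
set_option linter.dupNamespace false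

namespace Summit.NavierStokesRegularity.NavierStokesRegularity.Theorems

/-- **Giga–Miura 2011, Rmk. 2.8 (`L^a(L^b)` family) — the named Literature statement holds**
(discharge of `Literature.Analysis.FluidPDE.gigaMiura2011_directionGradient_LaLb_typeI` by the tree
theorem `hasSmoothExtensionPast_of_directionGradient_LaLb_typeI`).
[cite: GigaMiura2011, Rmk. 2.8 with Cor. 2.6 / Rmk. 2.7 (§2.1; HUPS preprint #956 pp. 9–10)] -/
theorem gigaMiura2011_directionGradient_LaLb_typeI_holds :
    Literature.Analysis.FluidPDE.gigaMiura2011_directionGradient_LaLb_typeI := by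
  intro ν T hν hT u p hsol hLH hbdd hI a b hb3 hab hD
  exact hasSmoothExtensionPast_of_directionGradient_LaLb_typeI hν hT hsol hLH hbdd hI hb3 hab hD

end Summit.NavierStokesRegularity.NavierStokesRegularity.Theorems
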